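import Summits.NavierStokesRegularity.NavierStokesRegularity.Theses.RellichScar
import Summits.NavierStokesRegularity.NavierStokesRegularity.Theorems.ScarRigidity.Negative.LogicAndLoadBearing
import Literature.Analysis.FluidPDE.TypeIAncientMild
import Literature.Analysis.FluidPDE.ParasiticSlabFlow
import Summits.NavierStokesRegularity.NavierStokesRegularity.Theorems.RellichScarScarRigidityApexBounds
import Summits.NavierStokesRegularity.NavierStokesRegularity.Theorems.RellichScarScarRigidityApexBoundsGauge
import HarnessLib

/-!
# `ScarRigidity` — line `finite-energy-log-convexity`, stub `stub_apexDerivativeBounds`: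
# the statement with the gauge `a(t)` (crux stmt-NavierStokesRegularity-11717, route RellichScar)

**S1β with the pressure gauge made explicit.** For a Type-I ancient mild apex profile `V`
(`IsTypeIAncientMild C V`, `HasTypeIDecay C V`) there are a jointly smooth pressure `Q` with
`(V, Q)` classical on the open slab `(-∞, 0) × ℝ³`, a function of time `a : ℝ → ℝ` (the value of
`Q(t, ·)` at spatial infinity), and `L ≥ 0` with, for all `t < 0` and all `x`,

  `‖∇V‖ ≤ L/(‖x‖+√(-t))²`, `‖D²V‖, ‖∂ₜV‖, ‖∇Q‖ ≤ L/(‖x‖+√(-t))³`, `|Q(t,x) - a(t)| ≤ L/(‖x‖+√(-t))²`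

(`apexDerivativeBounds_gaugeFree` and, slice by slice, the spatial limit of a function with
cubically decaying gradient, `exists_limit_of_norm_fderiv_le`). This is the registered stub
`stub_apexDerivativeBounds` with its clause `|Q| ≤ L/(‖x‖+√(-t))²` replaced by
`|Q - a(t)| ≤ L/(‖x‖+√(-t))²`: the Leray gauge `a ≡ 0` cannot be imposed while keeping `Q`
jointly `C^∞` without the spatial decay of all time derivatives of `V`, which the tree does not
provide.
-/

noncomputable section

open Set Filter Function MeasureTheory Metric TopologicalSpace
open scoped Topology ENNReal NNReal InnerProductSpace RealInnerProductSpace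
open Literature.Analysis.FluidPDE
open Summit.NavierStokesRegularity.NavierStokesRegularity.Theses.RellichScar
open Summit.NavierStokesRegularity.NavierStokesRegularity.Theorems.ScarRigidity.Negative

set_option linter.dupNamespace false

namespace Summit.NavierStokesRegularity.NavierStokesRegularity.Theorems.RellichScarScarRigidity

open Literature.Analysis

/-- **S1β with the gauge `a(t)`** (module docstring). [cite: KochNadirashviliSereginSverak2009, Prop. 4.1 (arXiv:0709.3599v1 p. 8)] [cite: SereginSverak2009, §2 p. 8] -/
theorem apexDerivativeBounds_withGauge :
    ∀ (V : ℝ → (EuclideanSpace ℝ (Fin 3)) → (EuclideanSpace ℝ (Fin 3))) (C : ℝ), 0 < C → IsTypeIAncientMild C V → HasTypeIDecay C V →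
      ∃ (Q : ℝ → (EuclideanSpace ℝ (Fin 3)) → ℝ) (a : ℝ → ℝ) (L : ℝ), 0 ≤ L ∧ IsClassicalNSSolutionOn (Iio (0 : ℝ)) 1 0 V Q ∧
        (∀ t < 0, ∀ x : (EuclideanSpace ℝ (Fin 3)), ‖fderiv ℝ (V t) x‖ ≤ L / (‖x‖ + Real.sqrt (-t)) ^ 2) ∧
        (∀ t < 0, ∀ x : (EuclideanSpace ℝ (Fin 3)), ‖iteratedFDeriv ℝ 2 (V t) x‖ ≤ L / (‖x‖ + Real.sqrt (-t)) ^ 3) ∧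
        (∀ t < 0, ∀ x : (EuclideanSpace ℝ (Fin 3)), ‖deriv (fun s => V s x) t‖ ≤ L / (‖x‖ + Real.sqrt (-t)) ^ 3) ∧
        (∀ t < 0, ∀ x : (EuclideanSpace ℝ (Fin 3)), |Q t x - a t| ≤ L / (‖x‖ + Real.sqrt (-t)) ^ 2) ∧
        (∀ t < 0, ∀ x : (EuclideanSpace ℝ (Fin 3)), ‖gradient (Q t) x‖ ≤ L / (‖x‖ + Real.sqrt (-t)) ^ 3) := by
  intro V C hC hV hd
  obtain ⟨Q, L, hL0, hQ, h1, h2, h3, h4⟩ := apexDerivativeBounds_gaugeFree V C hC hV hd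
  -- the slice-wise limits at spatial infinity
  have hlim : ∀ t < 0, ∃ A : ℝ, ∀ x : (EuclideanSpace ℝ (Fin 3)), |Q t x - A| ≤ L / (2 * (‖x‖ + Real.sqrt (-t)) ^ 2) := by
    intro t ht
    have hdiff : Differentiable ℝ (Q t) := (hQ.contDiff_pressure ht).differentiable (by simp)
    refine exists_limit_of_norm_fderiv_le hdiff hL0 (Real.sqrt_pos.2 (neg_pos.2 ht)) fun y => ?_
    have h := h4 t ht y
    rwa [gradient, LinearIsometryEquiv.norm_map] at h
  choose! A hA using hlim
  refine ⟨Q, A, L, hL0, hQ, h1, h2, h3, fun t ht x => ?_, h4⟩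
  refine (hA t ht x).trans ?_
  have hden : 0 < (‖x‖ + Real.sqrt (-t)) ^ 2 :=
    pow_pos (add_pos_of_nonneg_of_pos (norm_nonneg _) (Real.sqrt_pos.2 (neg_pos.2 ht))) 2
  rw [div_le_div_iff₀ (by positivity) hden]
  nlinarith

/-! ## Registered sub-goal (helper stub of `stub_apexDerivativeBounds`) -/

/-- **Registered helper stub `stub_apexDerivativeBoundsWithGauge`** (the corrected form of
`stub_apexDerivativeBounds`, crux stmt-NavierStokesRegularity-11717): as registered, with the
pressure's value at spatial infinity `a(t)` subtracted in the fifth clause.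
[cite: KochNadirashviliSereginSverak2009, Prop. 4.1 (arXiv:0709.3599v1 p. 8)] [cite: SereginSverak2009, §2 p. 8] -/
theorem stub_apexDerivativeBoundsWithGauge :
    ∀ (V : ℝ → EuclideanSpace ℝ (Fin 3) → EuclideanSpace ℝ (Fin 3)) (C : ℝ), 0 < C →
      IsTypeIAncientMild C V → HasTypeIDecay C V →
      ∃ (Q : ℝ → EuclideanSpace ℝ (Fin 3) → ℝ) (a : ℝ → ℝ) (L : ℝ), 0 ≤ L ∧
        IsClassicalNSSolutionOn (Iio (0 : ℝ)) 1 0 V Q ∧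
        (∀ t < 0, ∀ x : EuclideanSpace ℝ (Fin 3), ‖fderiv ℝ (V t) x‖ ≤ L / (‖x‖ + Real.sqrt (-t)) ^ 2) ∧
        (∀ t < 0, ∀ x : EuclideanSpace ℝ (Fin 3),
          ‖iteratedFDeriv ℝ 2 (V t) x‖ ≤ L / (‖x‖ + Real.sqrt (-t)) ^ 3) ∧
        (∀ t < 0, ∀ x : EuclideanSpace ℝ (Fin 3),
          ‖deriv (fun s => V s x) t‖ ≤ L / (‖x‖ + Real.sqrt (-t)) ^ 3) ∧
        (∀ t < 0, ∀ x : EuclideanSpace ℝ (Fin 3), |Q t x - a t| ≤ L / (‖x‖ + Real.sqrt (-t)) ^ 2) ∧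
        (∀ t < 0, ∀ x : EuclideanSpace ℝ (Fin 3),
          ‖gradient (Q t) x‖ ≤ L / (‖x‖ + Real.sqrt (-t)) ^ 3) :=
  apexDerivativeBounds_withGauge

end Summit.NavierStokesRegularity.NavierStokesRegularity.Theorems.RellichScarScarRigidity

end
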